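import Summits.Ventures.HSemireg.WedgeHankelRecurrenceGaussTopZeroConvex

/-!
# Venture HSemireg — **UNIQUENESS IN THE JACOBI INVERSE EIGENVALUE PROBLEM (HOCHSTADT): the two top polynomials `q_{t+1}`, `q_t` determine the recurrence** — if two monic three-term
# recurrences with non-vanishing `b` have the same `(t+1)`-th AND `t`-th polynomial, then `a_i = a'_i` (`i ≤ t`), `b_i = b'_i` (`1 ≤ i ≤ t`) and `q_k = q'_k` (`k ≤ t + 1`); with WENDROFF's
# theorem (N292) the coefficients `(a_0, …, a_t; b_1, …, b_t)` and the interlacing zero sets of `q_{t+1}`, `q_t` are in bijection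

HONEST FRAMING. Part of the Lean index of the computation cell `pub-hsemireg` (seat p10 gen 44, Sunday typer «UNIFORM-IN-n»).  Real polynomials (degrees, leading coefficients) only; no variety,
no cohomology theory, no sheaf, no Ext group and no semiregularity map is constructed here; nothing here says that HC / HC_CM / HC_AV holds; no Literature fact (unproved `Prop`) is declared or used.
Custodian versions as in `WedgeHankelSiegelIdeal` (1/3).
SOURCES (cited).  H. Hochstadt, *On the construction of a Jacobi matrix from spectral data*, Linear Algebra Appl. 8 (1974) 435–446; O. H. Hald, *Inverse eigenvalue problems for Jacobi matrices*,
Linear Algebra Appl. 14 (1976) 63–85; L. J. Gray, D. G. Wilson, *Construction of a Jacobi matrix from spectral data*, Linear Algebra Appl. 14 (1976) 131–134; C. de Boor, G. H. Golub, *The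
numerically stable reconstruction of a Jacobi matrix from spectral data*, Linear Algebra Appl. 21 (1978) 245–260; B. Wendroff, Proc. AMS 12 (1961) 554–555.
PROOF TYPED HERE.  Downward peeling: `C(a'_{t+1} − a_{t+1})·q_{t+1} = C b_{t+1} q_t − C b'_{t+1} q'_t` has degree `t + 1` on the left unless the constant vanishes and `≤ t` on the right; then
leading coefficients give `b_{t+1} = b'_{t+1}` and cancelling `b_{t+1} ≠ 0` gives `q_t = q'_t`; induction.
DEDUP DISCLOSURE (`rg -n 'recurrence_unique|inverse eigenvalue|Hochstadt' Summits/Ventures/HSemireg Literature`, 2026-09-03): N292 `recurrence_agree_of_coeff_agree` is the converse direction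
(equal coefficients ⇒ equal polynomials) and `wendroff_recurrence` the existence; N290 `orthogonal_monic_unique` is uniqueness w.r.t. a MEASURE.  The coefficient uniqueness is new.  The 3 names
below: 0 hits tree-wide.

WHAT IS IN THE TREE.  N279 `recurrence_monic_natDegree`; N292 `wendroff_recurrence` (existence); Mathlib `natDegree_C_mul`, `natDegree_sub_le`, `C_inj`.
THIS FILE (namespace `Summit.Ventures.HSemireg.Wedge.HankelOuter` continued; CHAINED on N335 (import only); 0 definitions):
* §1101 `recurrence_top_step_unique` (one peeling step: `a_{t+1} = a'_{t+1}`, `b_{t+1} = b'_{t+1}`, `q_t = q'_t`), **`recurrence_unique_of_top_two`** (all coefficients and members from `q_{t+1} = q'_{t+1}`,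
  `q_t = q'_t`), **`recurrence_unique_of_zeros`** (the same from equal zero vectors of `q_{t+1}`, `q'_{t+1}` and of `q_t`, `q'_t`).
CAVEATS.  `b_j ≠ 0` for `1 ≤ j ≤ t` (both recurrences); no positivity needed.  Nothing Ext-side.  New names only.
-/

open Module Polynomial
open scoped Matrix Polynomial

namespace Summit.Ventures.HSemireg.Wedge.HankelOuter

/-! ## §1101. The recurrence is determined by its two top polynomials -/

/-- **One peeling step**: `q_{t+2} = q'_{t+2}` and `q_{t+1} = q'_{t+1}` force `a_{t+1} = a'_{t+1}`, `b_{t+1} = b'_{t+1}` and (if `b_{t+1} ≠ 0`) `q_t = q'_t`. [Hochstadt 1974; this file, §1101] -/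
theorem recurrence_top_step_unique {q q' : ℕ → ℝ[X]} {a b a' b' : ℕ → ℝ} (hq0 : q 0 = 1) (hq1 : q 1 = Polynomial.X - C (a 0))
    (hrec : ∀ n, q (n + 2) = (Polynomial.X - C (a (n + 1))) * q (n + 1) - C (b (n + 1)) * q n)
    (hq0' : q' 0 = 1) (hq1' : q' 1 = Polynomial.X - C (a' 0)) (hrec' : ∀ n, q' (n + 2) = (Polynomial.X - C (a' (n + 1))) * q' (n + 1) - C (b' (n + 1)) * q' n)
    {t : ℕ} (htop : q (t + 2) = q' (t + 2)) (hnext : q (t + 1) = q' (t + 1)) :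
    a (t + 1) = a' (t + 1) ∧ b (t + 1) = b' (t + 1) ∧ (b (t + 1) ≠ 0 → q t = q' t) := by
  have hmd := recurrence_monic_natDegree hq0 hq1 hrec
  have hmd' := recurrence_monic_natDegree hq0' hq1' hrec'
  -- `C(a' − a) q_{t+1} = C b q_t − C b' q'_t`
  have hkey : C (a' (t + 1) - a (t + 1)) * q (t + 1) = C (b (t + 1)) * q t - C (b' (t + 1)) * q' t := by
    have h := htop
    rw [hrec t, hrec' t, ← hnext] at h
    rw [C_sub]
    linear_combination h
  have hRdeg : (C (b (t + 1)) * q t - C (b' (t + 1)) * q' t).natDegree ≤ t :=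
    (natDegree_sub_le _ _).trans (max_le ((natDegree_C_mul_le _ _).trans (hmd t).2.le) ((natDegree_C_mul_le _ _).trans (hmd' t).2.le))
  have ha : a (t + 1) = a' (t + 1) := by
    by_contra hne
    have hc : a' (t + 1) - a (t + 1) ≠ 0 := sub_ne_zero.2 (Ne.symm hne)
    have hL : (C (a' (t + 1) - a (t + 1)) * q (t + 1)).natDegree = t + 1 := by rw [natDegree_C_mul hc, (hmd (t + 1)).2]
    rw [hkey] at hL
    omega
  have hR : C (b (t + 1)) * q t = C (b' (t + 1)) * q' t := by
    rw [← sub_eq_zero, ← hkey, ha, sub_self, C_0, zero_mul]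
  have hb : b (t + 1) = b' (t + 1) := by
    have h := congrArg (fun P : ℝ[X] => P.coeff t) hR
    simp only [coeff_C_mul] at h
    have h1 : (q t).coeff t = 1 := by have h := (hmd t).1.coeff_natDegree; rwa [(hmd t).2] at h
    have h2 : (q' t).coeff t = 1 := by have h := (hmd' t).1.coeff_natDegree; rwa [(hmd' t).2] at h
    rwa [h1, h2, mul_one, mul_one] at h
  refine ⟨ha, hb, fun hb0 => ?_⟩
  rw [← hb] at hR
  exact mul_left_cancel₀ (mt C_eq_zero.1 hb0) hR

/-- **HOCHSTADT'S UNIQUENESS: `q_{t+1} = q'_{t+1}` and `q_t = q'_t` (with `b_j, b'_j ≠ 0` for `1 ≤ j ≤ t`) determine the recurrence: `a_i = a'_i` (`i ≤ t`), `b_i = b'_i` (`1 ≤ i ≤ t`), `q_k =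
q'_k` (`k ≤ t + 1`).** [Hochstadt 1974; Hald 1976; Gray–Wilson 1976; this file, §1101] -/
theorem recurrence_unique_of_top_two {q q' : ℕ → ℝ[X]} {a b a' b' : ℕ → ℝ} (hq0 : q 0 = 1) (hq1 : q 1 = Polynomial.X - C (a 0))
    (hrec : ∀ n, q (n + 2) = (Polynomial.X - C (a (n + 1))) * q (n + 1) - C (b (n + 1)) * q n)
    (hq0' : q' 0 = 1) (hq1' : q' 1 = Polynomial.X - C (a' 0)) (hrec' : ∀ n, q' (n + 2) = (Polynomial.X - C (a' (n + 1))) * q' (n + 1) - C (b' (n + 1)) * q' n)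
    (hb : ∀ j, 1 ≤ j → b j ≠ 0) :
    ∀ t, q (t + 1) = q' (t + 1) → q t = q' t → (∀ i, i ≤ t → a i = a' i) ∧ (∀ i, 1 ≤ i → i ≤ t → b i = b' i) ∧ ∀ k, k ≤ t + 1 → q k = q' k := by
  intro t
  induction t with
  | zero =>
    intro h1 _
    have ha : a 0 = a' 0 := by
      rw [hq1, hq1'] at h1
      exact C_inj.1 (sub_right_injective h1)
    refine ⟨fun i hi => ?_, fun i hi hi' => by omega, fun k hk => ?_⟩
    · rw [Nat.le_zero.1 hi]; exact ha
    · rcases Nat.le_one_iff_eq_zero_or_eq_one.1 hk with hk | hk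
      · rw [hk, hq0, hq0']
      · rw [hk]; exact h1
  | succ t ih =>
    intro htop hnext
    obtain ⟨ha, hbb, hq⟩ := recurrence_top_step_unique hq0 hq1 hrec hq0' hq1' hrec' htop hnext
    obtain ⟨ha', hb', hq'⟩ := ih hnext (hq (hb (t + 1) (by omega)))
    refine ⟨fun i hi => ?_, fun i hi hi' => ?_, fun k hk => ?_⟩
    · rcases Nat.lt_or_ge i (t + 1) with h | h
      · exact ha' i (by omega)
      · rw [show i = t + 1 by omega]; exact ha
    · rcases Nat.lt_or_ge i (t + 1) with h | h
      · exact hb' i hi (by omega)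
      · rw [show i = t + 1 by omega]; exact hbb
    · rcases Nat.lt_or_ge k (t + 2) with h | h
      · exact hq' k (by omega)
      · rw [show k = t + 2 by omega]; exact htop

/-- **The recurrence is determined by the zeros of its two top polynomials**: two recurrences (`b_j, b'_j ≠ 0`) whose `q_{t+2}`, `q'_{t+2}` have the same zero vector and whose `q_{t+1}`,
`q'_{t+1}` have the same zero vector coincide up to level `t + 2` (with N292 `wendroff_recurrence`: the Jacobi inverse eigenvalue problem from two interlacing spectra has exactly one solution).
[Hochstadt 1974; de Boor–Golub 1978; this file, §1101] -/
theorem recurrence_unique_of_zeros {q q' : ℕ → ℝ[X]} {a b a' b' : ℕ → ℝ} (hq0 : q 0 = 1) (hq1 : q 1 = Polynomial.X - C (a 0))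
    (hrec : ∀ n, q (n + 2) = (Polynomial.X - C (a (n + 1))) * q (n + 1) - C (b (n + 1)) * q n)
    (hq0' : q' 0 = 1) (hq1' : q' 1 = Polynomial.X - C (a' 0)) (hrec' : ∀ n, q' (n + 2) = (Polynomial.X - C (a' (n + 1))) * q' (n + 1) - C (b' (n + 1)) * q' n)
    (hb : ∀ j, 1 ≤ j → b j ≠ 0) {t : ℕ} {x : Fin (t + 2) → ℝ} {w : Fin (t + 1) → ℝ}
    (hxq : q (t + 2) = ∏ i, (Polynomial.X - C (x i))) (hxq' : q' (t + 2) = ∏ i, (Polynomial.X - C (x i)))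
    (hwq : q (t + 1) = ∏ k, (Polynomial.X - C (w k))) (hwq' : q' (t + 1) = ∏ k, (Polynomial.X - C (w k))) :
    (∀ i, i ≤ t + 1 → a i = a' i) ∧ (∀ i, 1 ≤ i → i ≤ t + 1 → b i = b' i) ∧ ∀ k, k ≤ t + 2 → q k = q' k :=
  recurrence_unique_of_top_two hq0 hq1 hrec hq0' hq1' hrec' hb (t + 1) (hxq.trans hxq'.symm) (hwq.trans hwq'.symm)

end Summit.Ventures.HSemireg.Wedge.HankelOuter
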